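import Summits.QuantumFields.YangMills.Theorems.IR.AfPincerUcXCovFemto
import Summits.QuantumFields.YangMills.Theorems.IR.AfPincerUcSharpLanes

/-!
# Crux `IR` (stmt-QuantumFields-19354), line `af-pincer`, X-side (lane (1)A): the femto conditional package NAMED and BY NAME —
# `SharpLanes.CovWindowAt G r (1/u)`, the lane (1)A contract, I♯_SC, the route decl through the residual, and the unit pin

Sequel of `Theorems/IR/AfPincerUcXCovFemto` (seat ym-19354-afpincer-s2, generation 3), written after the LEAD's
`Theorems/IR/AfPincerUcSharpLanes` (p535342: `SharpLanes.CovWindowAt` = UV-desk node candidate «N29», `CovEnvelopeAt`,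
`TypFormatAtScaleAt`, `LaneAContractSC`, the pin `mul_scale_lt_of_covWindow`) landed.

* §1 NAMES for the femto conditional package in a positive unit map `u` (X-desk typed asks, the hypotheses of
  `covWindow_of_femtoAF` verbatim): `Femto.CondOscAt G r u κ ℓ C₁` (E1-osc, collar form — the `NT` desk's engine item with `a ↦ u`),
  `Femto.CondCovAFAt G r u κ ℓ` (CondCovAF — the conditional two-point amplitude of `tr F²` is small at small physical separation,
  every exterior; = clause (A) of the `NT` desk's weak package `CFPW` with the constant `C₂` replaced by «`≤ W′` below physical
  separation `s′(W′)`» and a fixed physical collar `κ`), `Femto.FemtoAFAt G r u` (∃ `κ, ℓ > 2κ, C₁` with both).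
* §2 **`Femto.covWindowAt_of_femtoAFAt : FemtoAFAt G r u → SharpLanes.CovWindowAt G r (1/u)`** — the LEAD's named WINDOW BY NAME from the
  femto package (`covWindow_of_femtoAF`), and at every eventually smaller scale (`SharpLanes.covWindowAt_anti`).
* §3 `Femto.LaneAFemtoContractSC` (per simply connected `(G, r)`: admissible `(n, ε)`, a positive `u`, `TypFormatAtScaleAt … (1/u)`,
  `CovEnvelopeAt`, `FemtoAFAt G r u`) ⇒ `SharpLanes.LaneAContractSC` ⇒ `SharpOnset.OnsetSharpUKPcSC` (the registered `stub_onsetSharpSC`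
  type) ⇒ with the residual, `Theses.BalabanLadder.IR` — all BY NAME.
* §4 the unit pin BY NAME: `CovEnvelopeAt G r ∧ FemtoAFAt G r u ∧ LowerBounds G r a ⇒ a(β) < T₀ · u(β)` eventually
  (`Femto.unit_lt_mul_of_femtoAFAt`; the NT unit is never finer than the femto-AF unit by more than a constant), and cplan's
  `AFBelowScaleAt G r (1/u)` body with / without envelope (`afBelowScale_of_envelope_femtoAF`, `afBelowScale_of_femtoAF_of_compact`).

HONEST FRAMING.  Names and kernel compositions; every hypothesis (format at the UV unit, envelope, E1-osc, CondCovAF, the residual) is an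
OPEN statement about 4-d non-abelian lattice gauge theory at weak coupling; nothing here proves asymptotic freedom, mixing or a gap; one open
gap-crux of a CONDITIONAL chain (Track A 0/28 UV); not Clay.  No `sorry`; axioms ⊆ {propext, Classical.choice, Quot.sound}.
-/

set_option autoImplicit false

noncomputable section

open Filter Topology Finset MeasureTheory
open scoped BigOperators SchwartzMap
open Literature.MathematicalPhysics.QuantumFieldTheory hiding ZdEdge
open Literature.MathematicalPhysics.QuantumLattice
open Literature.Probability.LatticeModels (Site box mem_box)
open Summit.QuantumFields.YangMills.Cruxes.OSLegsFromFemtoAndGap.DlrCollarTransfer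

namespace Summit.QuantumFields.YangMills.Cruxes.IR.AfPincerUc.Femto

open Summit.QuantumFields.YangMills.Cruxes.IR.AfPincerUc
open Summit.QuantumFields.YangMills.Cruxes.IR.AfPincerUc.SharpLanes

/-! ## §1 The femto conditional package in unit `u`, NAMED (X-desk typed asks) -/
section Names

variable (G : Type) [Group G] [TopologicalSpace G] [IsTopologicalGroup G] [CompactSpace G]
  [MeasurableSpace G] [BorelSpace G] (r : LatticeRep G)

/-- **E1-osc in unit `u`, collar form** (the `NT` desk's engine item, `Theorems/BalabanLadderNTReferenceTorusCollar`, with `a ↦ u`):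
for all large `β`, on femto cubes (`b · u β ≤ ℓ`), the cube-kernel MEAN of the action density at a site of physical depth `≥ κ`
oscillates over exteriors by at most `C₁ / depth⁴`.  OPEN (exterior-uniform boundary law at weak coupling). -/
def CondOscAt (u : ℝ → ℝ) (κ ℓ C₁ : ℝ) : Prop :=
  ∃ β₁ : ℝ, ∀ β : ℝ, β₁ ≤ β → ∀ (c : Fin 4 → ℤ) (b : ℕ), (b : ℝ) * u β ≤ ℓ →
    ∀ (η η' : LGConfig 4 G) (x : Fin 4 → ℤ), κ / u β ≤ (depth c b x : ℝ) →
      |kerE G r β c b η (dens G r x) - kerE G r β c b η' (dens G r x)| ≤ C₁ / (depth c b x : ℝ) ^ 4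

/-- **CondCovAF in unit `u` — conditional asymptotic freedom of the two-point amplitude.**  For every `W′ > 0` there are `s′ > 0`, `β′`
such that for `β ≥ β′`, on femto cubes, for EVERY exterior `η`, at sites of lattice separation `≥ n₀`, physical depth `≥ κ` and physical
separation `‖y−x‖ · u β ≤ s′`: `‖y−x‖⁸ · |kerCov^η(A_x, A_y)| ≤ W′`.  (Clause (A) of the `NT` desk's weak package with `C₂ ↦ W′ → 0`;
implied by the upper half of `DlrCollarTransfer.FC2 G r u` plus `Γ(0⁺) = 0`.)  OPEN (background-field asymptotic freedom of `tr F²`). -/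
def CondCovAFAt (u : ℝ → ℝ) (κ ℓ : ℝ) : Prop :=
  ∃ n₀ : ℕ, ∀ W' : ℝ, 0 < W' → ∃ s' β' : ℝ, 0 < s' ∧ ∀ β : ℝ, β' ≤ β →
    ∀ (c : Fin 4 → ℤ) (b : ℕ), (b : ℝ) * u β ≤ ℓ → ∀ (η : LGConfig 4 G) (x y : Fin 4 → ℤ),
      (n₀ : ℝ) ≤ ‖siteToE (y - x)‖ → κ / u β ≤ (depth c b x : ℝ) → κ / u β ≤ (depth c b y : ℝ) →
        ‖siteToE (y - x)‖ * u β ≤ s' →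
          ‖siteToE (y - x)‖ ^ 8 * |kerCov G r β c b η (dens G r x) (dens G r y)| ≤ W'

/-- **The femto conditional AF package in unit `u`**: a physical collar `κ > 0`, a femto range `ℓ > 2κ` and a constant `C₁ ≥ 0`
carrying E1-osc and CondCovAF. -/
def FemtoAFAt (u : ℝ → ℝ) : Prop :=
  ∃ κ ℓ C₁ : ℝ, 0 < κ ∧ 2 * κ < ℓ ∧ 0 ≤ C₁ ∧ CondOscAt G r u κ ℓ C₁ ∧ CondCovAFAt G r u κ ℓ

end Names

/-! ## §2 The LEAD's named WINDOW BY NAME from the femto package -/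
section Window

variable {G : Type} [Group G] [TopologicalSpace G] [IsTopologicalGroup G] [CompactSpace G]
  [MeasurableSpace G] [BorelSpace G]

/-- **`SharpLanes.CovWindowAt G r (1/u)` from the femto conditional AF package in unit `u` (PROVED reduction, `covWindow_of_femtoAF`).**
[kernel reduction; hypotheses OPEN] -/
theorem covWindowAt_of_femtoAFAt (r : LatticeRep G) {u : ℝ → ℝ} (hu : ∀ β, 0 < u β) (h : FemtoAFAt G r u) :
    CovWindowAt G r (fun β => 1 / u β) := by
  obtain ⟨κ, ℓ, C₁, hκ, hκℓ, hC₁, hE1, hAF⟩ := h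
  exact covWindow_of_femtoAF r u hu hκ hκℓ hC₁ hE1 hAF

/-- … hence at every scale eventually `≤ 1/u` (`SharpLanes.covWindowAt_anti`). -/
theorem covWindowAt_of_femtoAFAt_of_le (r : LatticeRep G) {u : ℝ → ℝ} (hu : ∀ β, 0 < u β) (h : FemtoAFAt G r u)
    {ℓ : ℝ → ℝ} (hle : ∃ β₃ : ℝ, ∀ β : ℝ, β₃ ≤ β → ℓ β ≤ 1 / u β) : CovWindowAt G r ℓ :=
  covWindowAt_anti (covWindowAt_of_femtoAFAt r hu h) hle

end Window

/-! ## §3 The lane (1)A contract with the femto package on the X-side, and the glue BY NAME -/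

/-- **Lane (1)A contract, femto form (SC family).**  For every simply connected compact simple `G` and every `r`: ONE admissible `(n, ε)`
and ONE positive unit map `u` carrying the I-side format at scale `1/u` (`TypFormatAtScaleAt`), the ENVELOPE and the femto conditional AF
package in unit `u`. -/
def LaneAFemtoContractSC : Prop :=
  ∀ (G : Type) [Group G] [TopologicalSpace G] [IsTopologicalGroup G] [CompactSpace G],
    IsCompactSimpleLieGroup G → SimplyConnectedSpace G →
    letI : MeasurableSpace G := borel G; haveI : BorelSpace G := ⟨rfl⟩;
    ∀ r : LatticeRep G, ∃ (n : ℕ) (ε : ℝ), 1 ≤ n ∧ 0 ≤ ε ∧ ε * OnsetFormats.shellCount n ≤ 3 / 4 ∧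
      ∃ u : ℝ → ℝ, (∀ β, 0 < u β) ∧ TypFormatAtScaleAt r.ρ n ε (fun β => 1 / u β) ∧ CovEnvelopeAt G r ∧ FemtoAFAt G r u

/-- **Femto contract ⇒ the LEAD's lane (1)A contract (PROVED).** -/
theorem laneAContractSC_of_femto (h : LaneAFemtoContractSC) : LaneAContractSC := by
  intro G _ _ _ _ hG hsc
  letI : MeasurableSpace G := borel G
  haveI : BorelSpace G := ⟨rfl⟩
  intro r
  obtain ⟨n, ε, hn, hε, hM, u, hu, hF, henv, hfem⟩ := h G hG hsc r
  exact ⟨n, ε, hn, hε, hM, fun β => 1 / u β, hF, henv, covWindowAt_of_femtoAFAt r hu hfem⟩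

/-- **Femto contract ⇒ I♯_SC = the registered `stub_onsetSharpSC` type, BY NAME (PROVED composition).** [hypotheses OPEN] -/
theorem onsetSharpUKPcSC_of_laneAFemtoContractSC (h : LaneAFemtoContractSC) : SharpOnset.OnsetSharpUKPcSC :=
  onsetSharpUKPcSC_of_laneAContractSC (laneAContractSC_of_femto h)

/-- **Femto contract ∧ residual ⇒ `Theses.BalabanLadder.IR` BY NAME (PROVED composition; E discharged by p524017, no X-stub).** -/
theorem ir_of_laneAFemtoContractSC (h : LaneAFemtoContractSC) (hN : SharpOnset.IRNSC) :
    Summit.QuantumFields.YangMills.Theses.BalabanLadder.IR :=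
  ir_of_laneAContractSC (laneAContractSC_of_femto h) hN

/-! ## §4 The unit pin and cplan's `AFBelowScaleAt (1/u)` BY NAME -/
section Pin

variable {G : Type} [Group G] [TopologicalSpace G] [IsTopologicalGroup G] [CompactSpace G]
  [MeasurableSpace G] [BorelSpace G]

/-- **The unit pin (PROVED): the NT unit is at most a constant times the femto-AF unit.**  ENVELOPE, the femto conditional AF package in unit
`u`, and a positive unit `a` carrying `LowerBounds G r a` give `T₀, β₁` with `a(β) < T₀ · u(β)` for `β ≥ β₁` (`SharpLanes.mul_scale_lt_of_covWindow`
at `ℓ = 1/u`). -/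
theorem unit_lt_mul_of_femtoAFAt (r : LatticeRep G) (a u : ℝ → ℝ) (ha : ∀ β, 0 < a β) (hu : ∀ β, 0 < u β)
    (henv : CovEnvelopeAt G r) (h : FemtoAFAt G r u) (hlb : LowerBounds G r a) :
    ∃ T₀ β₁ : ℝ, ∀ β : ℝ, β₁ ≤ β → a β < T₀ * u β := by
  obtain ⟨T₀, β₁, hT⟩ := mul_scale_lt_of_covWindow r a (fun β => 1 / u β) ha henv (covWindowAt_of_femtoAFAt r hu h) hlb
  refine ⟨T₀, β₁, fun β hβ => ?_⟩
  have h1 := hT β hβ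
  have hu' := hu β
  have e : a β * (1 / u β) = a β / u β := by ring
  rw [e, div_lt_iff₀ hu'] at h1
  exact h1

/-- **cplan's `AFBelowScaleAt G r (1/u)` (body verbatim) from the ENVELOPE and the femto conditional AF package** (generation 2's
`afBelowScale_of_covarianceAF` at `ℓ = 1/u`). [kernel composition; hypotheses OPEN] -/
theorem afBelowScale_of_envelope_femtoAFAt (r : LatticeRep G) {u : ℝ → ℝ} (hu : ∀ β, 0 < u β)
    (henv : CovEnvelopeAt G r) (h : FemtoAFAt G r u)
    (v : 𝓢(EuclideanSpace ℝ (Fin 4), ℝ)) (hv : tsupport v ⊆ {y : EuclideanSpace ℝ (Fin 4) | 0 < y 0})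
    {η : ℝ} (hη : 0 < η) :
    ∃ T β₁ : ℝ, ∀ β : ℝ, β₁ ≤ β → ∀ s : ℝ, 0 < s → T ≤ s * (1 / u β) →
      ∃ᶠ (L : ℕ) in atTop, |Q2 G r β L s (thetaTest 4 v) v| ≤ η :=
  afBelowScale_of_covarianceAF r (fun β => 1 / u β) henv (covWindowAt_of_femtoAFAt r hu h) v hv hη

/-- **Compactly supported test function: `AFBelowScaleAt G r (1/u)` from the femto package ALONE — no envelope** (generation 2's
`afBelowScale_clause_of_covarianceAF_of_compact`). [kernel composition; hypotheses OPEN] -/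
theorem afBelowScale_of_femtoAFAt_of_compact (r : LatticeRep G) {u : ℝ → ℝ} (hu : ∀ β, 0 < u β) (h : FemtoAFAt G r u)
    (v : 𝓢(EuclideanSpace ℝ (Fin 4), ℝ)) (hv : tsupport v ⊆ {y : EuclideanSpace ℝ (Fin 4) | 0 < y 0})
    (hvc : HasCompactSupport v) {η : ℝ} (hη : 0 < η) :
    ∃ T β₁ : ℝ, ∀ β : ℝ, β₁ ≤ β → ∀ s : ℝ, 0 < s → T ≤ s * (1 / u β) →
      ∃ᶠ (L : ℕ) in atTop, |Q2 G r β L s (thetaTest 4 v) v| ≤ η :=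
  afBelowScale_clause_of_covarianceAF_of_compact r (fun β => 1 / u β) (covWindowAt_of_femtoAFAt r hu h) v hv hvc hη

end Pin

end Summit.QuantumFields.YangMills.Cruxes.IR.AfPincerUc.Femto

end
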